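import Literature.NumberTheory.DiophantineGeometry.AbcShapeGeometrySets

-- Summit.ABC.ABC is the mandated summit-side namespace (single-conjunct summit); the lakefile sets the same option tree-wide.
set_option linter.dupNamespace false

/-!
# Exact equalities `a² C = b² D` are rare (crux stmt-ABC-2757, stub `de_card_sq_mul_eq_le`)

Helper file for the DE tool (short-vector count) of the line `critical-kloosterman-powerful-moduli`
for the crux `Summit.ABC.ABC.Theses.TwistAmplification.MazurKaneLaw`.  It proves the registered
stub `de_card_sq_mul_eq_le`: for `a, b ∈ [1, M]`, `C ∈ 𝒞` (a finite set of positive naturals) and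
`D ∈ 𝒟` (any finite set of naturals), the tuples `((a, C), (b, D))` with `a² C = b² D` *exactly*
number at most `M · #𝒞 · Dτ`, where `Dτ` bounds the number of divisors of every `a² C` with
`a ∈ [1, M]`, `C ∈ 𝒞`.

Proof: fibre over `(a, C)`.  In one fibre the value `v = a² C ≠ 0` is fixed, the map `(b, D) ↦ b`
is injective on it (`b ≥ 1`, so `b² D = v` determines `D`) with image in the divisors of `v`
(`b ∣ b² D = v`), so the fibre has at most `τ(v) ≤ Dτ` elements
(`de_card_fibre_sq_mul_le_card_divisors`); there are `#([1, M] × 𝒞) = M · #𝒞` fibres.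

No new definitions; folklore divisor-counting bookkeeping.
-/

namespace Summit.ABC.ABC.Theorems.MazurKaneLaw

open Finset

/-- One fibre of the exact count: for `v ≠ 0`, the pairs `(b, D) ∈ [1, M] × 𝒟` with `v = b² D`
number at most `τ(v)` (the map `(b, D) ↦ b` is injective on them, since `b ≥ 1` and `b² D = v`
determine `D`, and it lands in `v.divisors`). [folklore] -/
theorem de_card_fibre_sq_mul_le_card_divisors (M : ℕ) (𝒟 : Finset ℕ) {v : ℕ} (hv : v ≠ 0) :
    ((Finset.Icc 1 M ×ˢ 𝒟).filter (fun q : ℕ × ℕ => v = q.1 ^ 2 * q.2)).card ≤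
      v.divisors.card := by
  refine Finset.card_le_card_of_injOn (fun q : ℕ × ℕ => q.1) (fun q hq => ?_)
    (fun q hq q' hq' h => ?_)
  · rw [Finset.mem_coe, Finset.mem_filter] at hq
    simp only [Finset.mem_coe, Nat.mem_divisors]
    exact ⟨hq.2 ▸ (dvd_pow_self q.1 two_ne_zero).mul_right q.2, hv⟩
  · rw [Finset.mem_coe, Finset.mem_filter, Finset.mem_product, Finset.mem_Icc] at hq
    rw [Finset.mem_coe, Finset.mem_filter] at hq'
    obtain ⟨⟨⟨hb1, _⟩, _⟩, hqv⟩ := hq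
    have hb : q.1 = q'.1 := h
    have hsq : 0 < q.1 ^ 2 := pow_pos (by omega) 2
    have hD : q.2 = q'.2 := by
      refine Nat.eq_of_mul_eq_mul_left hsq ?_
      rw [← hqv, hq'.2, hb]
    exact Prod.ext hb hD

/-- **Exact equalities `a² C = b² D` are rare** (registered stub `de_card_sq_mul_eq_le` of the DE
tool, crux stmt-ABC-2757): for `a, b ∈ [1, M]`, `C ∈ 𝒞` (all positive) and `D ∈ 𝒟`, the tuples
`((a, C), (b, D))` with `a² C = b² D` number at most `M · #𝒞 · Dτ`, where `Dτ` bounds `τ(a² C)` for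
`a ∈ [1, M]`, `C ∈ 𝒞`.  Fibre over `(a, C)` (`Finset.card_eq_sum_card_fiberwise`), inject each
fibre into the pairs `(b, D)` with `b² D = a² C` via `p ↦ p.2`, and apply
`de_card_fibre_sq_mul_le_card_divisors`. [folklore] -/
theorem de_card_sq_mul_eq_le : ∀ (M Dτ : ℕ) (𝒞 𝒟 : Finset ℕ), (∀ C ∈ 𝒞, 0 < C) → (∀ m : ℕ, m ≠ 0 → (∃ a ∈ Finset.Icc 1 M, ∃ C ∈ 𝒞, m = a ^ 2 * C) → m.divisors.card ≤ Dτ) → ((((Finset.Icc 1 M ×ˢ 𝒞) ×ˢ (Finset.Icc 1 M ×ˢ 𝒟)).filter (fun p : (ℕ × ℕ) × (ℕ × ℕ) => p.1.1 ^ 2 * p.1.2 = p.2.1 ^ 2 * p.2.2)).card) ≤ M * 𝒞.card * Dτ := by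
  intro M Dτ 𝒞 𝒟 h𝒞 hτ
  set S := ((Finset.Icc 1 M ×ˢ 𝒞) ×ˢ (Finset.Icc 1 M ×ˢ 𝒟)).filter
    (fun p : (ℕ × ℕ) × (ℕ × ℕ) => p.1.1 ^ 2 * p.1.2 = p.2.1 ^ 2 * p.2.2) with hS
  have hmaps : Set.MapsTo (fun p : (ℕ × ℕ) × (ℕ × ℕ) => p.1) (S : Set ((ℕ × ℕ) × (ℕ × ℕ)))
      ((Finset.Icc 1 M ×ˢ 𝒞 : Finset (ℕ × ℕ)) : Set (ℕ × ℕ)) := by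
    intro p hp
    rw [Finset.mem_coe, hS, Finset.mem_filter, Finset.mem_product] at hp
    exact Finset.mem_coe.mpr hp.1.1
  rw [Finset.card_eq_sum_card_fiberwise hmaps]
  refine (Finset.sum_le_card_nsmul _ _ Dτ fun x hx => ?_).trans (le_of_eq ?_)
  · -- the fibre over `x = (a, C)`
    obtain ⟨ha, hxC⟩ := Finset.mem_product.mp hx
    have ha1 : 1 ≤ x.1 := (Finset.mem_Icc.mp ha).1
    have hv : x.1 ^ 2 * x.2 ≠ 0 := mul_ne_zero (pow_ne_zero 2 (by omega)) (h𝒞 x.2 hxC).ne'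
    have hτv : (x.1 ^ 2 * x.2).divisors.card ≤ Dτ := hτ _ hv ⟨x.1, ha, x.2, hxC, rfl⟩
    refine le_trans ?_ ((de_card_fibre_sq_mul_le_card_divisors M 𝒟 hv).trans hτv)
    refine Finset.card_le_card_of_injOn (fun p : (ℕ × ℕ) × (ℕ × ℕ) => p.2) (fun p hp => ?_)
      (fun p hp p' hp' h => ?_)
    · rw [Finset.mem_coe, Finset.mem_filter, hS, Finset.mem_filter, Finset.mem_product] at hp
      obtain ⟨⟨⟨_, hp2⟩, heq⟩, hpx⟩ := hp
      have hpx' : p.1 = x := hpx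
      simp only [Finset.mem_coe, Finset.mem_filter]
      exact ⟨hp2, by rw [← hpx']; exact heq⟩
    · rw [Finset.mem_coe, Finset.mem_filter] at hp hp'
      have h1 : p.1 = p'.1 := by rw [hp.2, hp'.2]
      have h2 : p.2 = p'.2 := h
      exact Prod.ext h1 h2
  · rw [Finset.card_product, Nat.card_Icc, Nat.add_sub_cancel, smul_eq_mul]

end Summit.ABC.ABC.Theorems.MazurKaneLaw
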